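import Mathlib
import HarnessLib
import Literature.Analysis.FluidPDE.Tao2016AveragedNS.TaylorChainCertificate
import Summits.NavierStokesRegularity.NavierStokesRegularity.Theses.ExactWindowRungThree
import Summits.NavierStokesRegularity.NavierStokesRegularity.Theorems.TaylorModelRungThreeDefs
import Summits.NavierStokesRegularity.NavierStokesRegularity.Theorems.TaylorModelRungThreeReadoutPackage
import Summits.NavierStokesRegularity.NavierStokesRegularity.Theorems.TaylorModelRungThreeReadoutFlow

/-!
# Line `taylor-model` on crux K1b-DR (stmt-NavierStokesRegularity-23954) — G-stub statements (skeleton v4.1) BY NAME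

Theorems defs module (text by the line owner ns-idea-2 g3, landed by the G-prover engine-1
`--supports stmt-NavierStokesRegularity-23954`; tags dropped on the parameterless stub Props so the gate keeps them summit-side): the window-flow interface `IsWindowFlow` and the four REGISTERED G-stub
statements of skeleton v4.1 (sha16 42b6425f90a56974) — `ChainEnclosureHolds` (G1), `CrossingReadouts` (G2), `TubeLip` (G3),
`LandingC1` (G4) — VERBATIM, so that stub proofs in `Theorems/TaylorModelRungThreeReadoutG<k>*.lean` can state
`theorem … : ChainEnclosureHolds` etc. by name (Theorems files cannot import the skeleton), plus the proved G0i
`windowFlowExists`.  Once landed, the skeleton re-points its stubs to these names (v4.2, text unchanged).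
MODEL-lattice rung TL-M3 only; nothing here is a statement about the Navier–Stokes equations; K1b-DR is NOT proved here.
-/

set_option linter.dupNamespace false

noncomputable section

namespace Summit.NavierStokesRegularity.NavierStokesRegularity.Theorems.TaylorModel

open scoped BigOperators
open Set

open Literature.Analysis.FluidPDE.TaoCascade.TaylorChain Summit.NavierStokesRegularity.NavierStokesRegularity.Theorems.TaylorModelReadout in
/-- WINDOW FLOW INTERFACE (v4.1): per stage `j ≤ N₀` a window-coordinate flow `Φ` carrying the full S1 conclusion set
`WindowPack cd j Φ` (existence/uniqueness, majorant value and Taylor-remainder bounds, first variation, second-order deviation,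
`HasFDerivAt` of every fixed-time map with operator and jet-relative bounds), and `φ j` is its zero-extended lift. [folklore] -/
def IsWindowFlow (cd : CertData) (φ : Flow) : Prop :=
  ∀ j, j ≤ cd.N₀ → ∃ Φ : (Fin (nW cd) → ℝ) → ℝ → Fin (nW cd) → ℝ, WindowPack cd j Φ ∧ φ j = liftFlow cd Φ

open Literature.Analysis.FluidPDE.TaoCascade.TaylorChain Summit.NavierStokesRegularity.NavierStokesRegularity.Theorems.TaylorModelReadout in
/-- G0i · window flow exists: S1 instantiated per stage (`n := nW cd`, `Q := Qw cd`, `w := wW cd j`, `b := cd.bb j`, jets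
`taylorJet`/`varJet`) — immediate from the landed `exists_windowPack` (hypotheses `0 < ω j k`, `0 ≤ bb j`, (B) from `StageNumerics`). -/
def WindowFlowExists : Prop :=
  ∀ cd : CertData, cd.Valid → TaylorModelSoundness →
    ∃ φ : Flow, IsWindowFlow cd φ

open Literature.Analysis.FluidPDE.TaoCascade.TaylorChain Summit.NavierStokesRegularity.NavierStokesRegularity.Theorems.TaylorModelReadout in
/-- G1 · chain enclosure (Lohner-chain soundness along the certificate). -/
def ChainEnclosureHolds : Prop :=
  ∀ (cd : CertData) (φ : Flow), cd.Valid → IsWindowFlow cd φ → ChainEnclosure cd φ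

open Literature.Analysis.FluidPDE.TaoCascade.TaylorChain Summit.NavierStokesRegularity.NavierStokesRegularity.Theorems.TaylorModelReadout in
/-- G2 · crossing time (IVT + transversality in the last sub-step) and the (E1) read-outs of K1b-DR. -/
def CrossingReadouts : Prop :=
  ∀ (cd : CertData) (φ : Flow), cd.Valid → IsWindowFlow cd φ → ChainEnclosure cd φ →
    Crossing cd φ (tauSel cd φ) ∧ KBlockE1 cd φ (tauSel cd φ)

open Literature.Analysis.FluidPDE.TaoCascade.TaylorChain Summit.NavierStokesRegularity.NavierStokesRegularity.Theorems.TaylorModelReadout in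
/-- G3 · κ-tube ODE clause and flow-Lipschitz segment derivatives of K1b-DR. -/
def TubeLip : Prop :=
  ∀ (cd : CertData) (φ : Flow), cd.Valid → IsWindowFlow cd φ → ChainEnclosure cd φ →
    Crossing cd φ (tauSel cd φ) → KBlockTube cd φ (tauSel cd φ) ∧ KBlockLip cd φ (tauSel cd φ)

open Literature.Analysis.FluidPDE.TaoCascade.TaylorChain Summit.NavierStokesRegularity.NavierStokesRegularity.Theorems.TaylorModelReadout in
/-- G4 · base landing and the C¹ landing allowance of K1b-DR (via the module's `landD` read-out clause, v2). -/
def LandingC1 : Prop :=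
  ∀ (cd : CertData) (φ : Flow), cd.Valid → IsWindowFlow cd φ → ChainEnclosure cd φ →
    Crossing cd φ (tauSel cd φ) → KBlockLand cd φ (tauSel cd φ)

open Literature.Analysis.FluidPDE.TaoCascade.TaylorChain Summit.NavierStokesRegularity.NavierStokesRegularity.Theorems.TaylorModelReadout in
/-- G0i is NOT a stub any more (v4.1): the window flow exists by the landed `exists_windowPack` (engine-1, p596316),
stage by stage, with the hypotheses read off `StageNumerics`. -/
theorem windowFlowExists : WindowFlowExists := by
  intro cd hV hS
  classical
  have hN := hV.2.1
  have hω : ∀ j, j ≤ cd.N₀ → ∀ k, 0 < cd.ω j k := fun j hj => (hN.1 j hj).2.2.2.2.2.2.1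
  refine ⟨fun j => if hj : j ≤ cd.N₀ then
      liftFlow cd (Classical.choose (exists_windowPack cd hS (hω j hj) (hN.2 j hj).1 (hN.2 j hj).2))
    else liftFlow cd (fun x _ => x), ?_⟩
  intro j hj
  refine ⟨Classical.choose (exists_windowPack cd hS (hω j hj) (hN.2 j hj).1 (hN.2 j hj).2), Classical.choose_spec _, ?_⟩
  simp [hj]

end Summit.NavierStokesRegularity.NavierStokesRegularity.Theorems.TaylorModel

end
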